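import Summits.MatrixMultiplication.MatrixMultiplication.Theorems.AbelianSTPPCensusTALin1200Defs2

/-!
# T_A/1200 certificate: kernel evaluation, volumes `558 … 629` (fine segments)

Cell mm-stpp (rung F-M1), T_A/1200 = «no abelian STPP host of order `≤ 1200` beats `τ = 2.371`»; checker in `AbelianSTPPCensusTALin1200Defs.lean`,
fine checkpoint states in `…TALin1200Defs2.lean`.  `decide` with kernel reduction (standard axioms; no `native_decide`); at most `120` sorted
candidate shapes per segment and `Elab.async false` (one kernel evaluation in memory at a time) — the 50-volume segments above volume `400`
exhausted kernel memory on some gate nodes.  Each segment recomputes the next checkpoint from the previous one and checks every sorted candidate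
shape of its volumes at every order `576 … 1200`; consumed by `TALin1200.seg_sound` / `TALin1200.loopL_sound` in
`AbelianSTPPCensusLeafTA1200Closed.lean`.
WHAT THIS IS NOT: arithmetic on shape lists only; no statement about STPP families or `ω`.
-/

set_option linter.dupNamespace false
set_option autoImplicit false
set_option Elab.async false

namespace Summit.MatrixMultiplication.MatrixMultiplication.Theorems.TALin1200

set_option maxHeartbeats 0 in
/-- Segment `558 … 575` (110 sorted shapes): from `st557` the loop reaches `st575`, all checks at orders `576 … 1200` passing. [original] -/
theorem sg558 : loopL 576 625 18 558 st557 = (true, st575) := by decide +kernel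

set_option maxHeartbeats 0 in
/-- Segment `576 … 593` (116 sorted shapes): from `st575` the loop reaches `st593`, all checks at orders `576 … 1200` passing. [original] -/
theorem sg576 : loopL 576 625 18 576 st575 = (true, st593) := by decide +kernel

set_option maxHeartbeats 0 in
/-- Segment `594 … 611` (102 sorted shapes): from `st593` the loop reaches `st611`, all checks at orders `576 … 1200` passing. [original] -/
theorem sg594 : loopL 576 625 18 594 st593 = (true, st611) := by decide +kernel

set_option maxHeartbeats 0 in
/-- Segment `612 … 629` (94 sorted shapes): from `st611` the loop reaches `st629`, all checks at orders `576 … 1200` passing. [original] -/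
theorem sg612 : loopL 576 625 18 612 st611 = (true, st629) := by decide +kernel

end Summit.MatrixMultiplication.MatrixMultiplication.Theorems.TALin1200
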